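import Literature.MathematicalPhysics.QuantumFieldTheory.Balaban1983to89.B9Eq3153FrakGkBoundDiagonal
import Literature.MathematicalPhysics.QuantumFieldTheory.Balaban1983to89.B9Eq3126H1BoundTowerVariational
import Literature.MathematicalPhysics.QuantumFieldTheory.Balaban1983to89.B11Eq117TransformationNorm

/-!
# `Balaban1983to89.B9Eq3126EnergyBallTowerCLM` — T. Bałaban, *The variational problem and background fields in renormalization group method for
# lattice gauge theories*, Commun. Math. Phys. **102** (1985) 277–309 [Balaban1985Variational] (117) p. 295 with (103) p. 293, (110)–(111) p. 294, (115)
# p. 294, and T. Bałaban, *Propagators for lattice gauge theories in a background field*, Commun. Math. Phys. **99** (1985) 389–434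
# [Balaban1985BackgroundPropagators] (3.126) p. 420, (3.153) p. 426, Thm 3.13 p. 426: THE (117)-ISOLATION — the `k`-level chart letters `H_{1,k}(U)`,
# `𝔊_k(U)` in the type `NegSize → Space115 … (∇_U)` bounded on print's diagonal by a LEVEL-FREE constant TIMES (117)'s EXPLICIT finite-lattice factor,
# `∃ α₀ C` BEFORE EVERY BINDER

statement-level skeleton of published theorems with citation tags; proofs where landed; nothing here is a claim about the Yang–Mills mass gap

CITATION HEADER (lean-in-tree rule).  Audit cell `pub-balaban`, sub-cell `t4`, BINDER row NE9; filed by the row OWNER lineage `b2b-balaban-t4-ne9-p1`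
(gen 87; plan v6, `g86/ENERGY-PROGRAMME.md` §5 (b2) «the chart consumer's currency»).  Sources READ by this lineage in the held texts:
[Balaban1985Variational] pp. 285, 293–295 (`paper:balaban1985-cmp102-variational-background`, journal page = PDF page + 276);
[Balaban1985BackgroundPropagators] pp. 416, 420, 425–426 (`paper:balaban1985-cmp99-background-propagators`, journal page = PDF page + 388).

THE PRINT (verbatim).  [Balaban1985Variational] p. 295 L7–L9: *«By Theorem 3.13 of [5] the norm max{| |_(−1), |∇ |_(−2)} of the transformation can be
estimated by [(117)] if ε₄ + B₀|B| ≤ a₃»*; [Balaban1985BackgroundPropagators] p. 426: *«The formulas (3.147), (3.153) permit us to reduce properties of the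
operators 𝔓, 𝔊 to the corresponding properties of the operators G′, (Q′G′²Q′*)⁻¹, G₁, (QG₁Q*)⁻¹»*, Thm 3.13: *«If an external gauge field configuration U
satisfies the regularity conditions (3.35), (3.36) for α₀ sufficiently small, then Theorems 3.3, 3.10, 3.11 hold for the propagator 𝔊»*.

WHY THIS FILE (cell context).  `B9Eq3126H1BoundTower.exists_H1k_frakGk_CLM_bound_of_small_field′` (this lineage, gen 83; consumed by
`Support/NE9CurChartTowerUniformBall` to choose the `k`-level chart radii BEFORE `∀ U`) bounds the chart letters `‖H1LatticeCLM …‖ ≤ C_H′`,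
`‖frakGLatticeCLM …‖ ≤ C_G′` with `C_H′ = K·(M_φC_H√(c₁#β)M_φ′∕√c₀)·w̲⁻¹ + 1`, where BOTH factors are level-dependent: `C_H`, `C_G` (the `L²` letters of
`B9Eq3126GreenLetters`, carrying `‖Δ_a‖ ∝ |η|⁻²`, `‖D‖ ∝ |η|⁻¹`, the adjoint modulus of `Q_k` — D-ne9p1-g85-1, D-ne9p1-g86-1) AND (117)'s comparison factor.
The energy programme (gens 84–87 + NE9 leaves 02∕03∕04) made the `L²` letters LEVEL-FREE on the diagonal.  This file ISOLATES the remainder: the same two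
operator norms bounded by `C·V_H`, `C·V_G` with `C` closed in `(d, a, L, M_φ, M_φ′, r, C_τ, ρ_w)` and `V_H`, `V_G` THE EXPLICIT (117) PRODUCTS
`max(w̄₀, w̄₁·2|η|⁻¹)·(M_φ√(c₁#β_m)M_φ′∕√c₀)·w̲_B⁻¹`, `max(w̄₀, w̄₁·2|η|⁻¹)·(M_φ√(c₀#β_k)M_φ′∕√c₀)·w̲₀⁻¹` — the volume factor and `M_∇ = 2|η|⁻¹` that print removes
by Thm 3.13's DECAY (random-walk expansion, Thms 3.10∕3.12; not in the tree).  After this file the residual non-uniformity of the `k`-level uniform ball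
is ONE displayed product per letter, nothing else.

WHAT IS PROVED (sorry-free; no `def`, no `Prop` placeholder; no inequality of the paper asserted hypothesis-free).
* **`exists_energy_ball_CLM_diagonal_closed`** — there are `α₀, C > 0` (`C` closed in `(d, a, L, M_φ, M_φ′, r, C_τ, ρ_w)`) such that for every `n`
  (`3 ≤ L^{n+1}`), `η > 0` (`ηL^{n+1} = 1`), `c₀, c₁` (`c₀(L^{n+1})^d = c₁`, `|η|^d∕c₀ ≤ ρ_w`), `m`, ANY level maps `lev₀, lev_B, lev₁`, every background
  `U` of E162's data which is unitary, `U(b) ∈ U1`, in the windows `‖U(b) − 1‖ ≤ αη`, `‖U(∂p) − 1‖ ≤ αη²`, `‖Ū^j(b) − 1‖ ≤ ε_j ≤ αr^j` (`0 ≤ α ≤ α₀`), and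
  ANY witnesses `hposU`, `hQU`:  `‖H1LatticeCLM φ hposU hQU lev₁ (∇_U)‖ ≤ C·V_H` and `‖frakGLatticeCLM φ hposU hQU lev₁ (∇_U)‖ ≤ C·V_G` with the two (117)
  products displayed verbatim.  MECHANISM: the level-free `L²` letters — NE9 leaf-02's `B9Eq3126H1BoundTowerVariational.exists_norm_KinvLatticeK_H1LatticeK_le_diagonal_closed`
  (`‖H_{1,k}(U)b‖ ≤ C_H‖b‖`) and this lineage's `B9Eq3153FrakGkBoundDiagonal.exists_norm_frakGk_le_diagonal_closed` (`‖𝔊_k(U)x‖ ≤ (16∕γ(d,a))‖x‖`, the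
  symmetry of `Δ_a` from unitarity + the trace letters, `hRS` likewise) — transported by `B11Eq117TransformationNorm.norm_H1CLM_le` ∕ `norm_frakG_fun_le`
  with `‖∇_U‖ ≤ 2|η|⁻¹` (`norm_nabla115_le`, unit-bounded `U`), exactly as `B9Eq3126H1BoundTower` §4 does one currency below.
HONEST SCOPE.  [folklore] composition by name; the (117) factors ARE load-bearing (finite-lattice numbers growing with the level and the volume) — this is
NOT print's lattice-uniform `B₀` (Thm 3.13's decay), only its `L²` half made uniform and the other half displayed; the small-field WINDOWS, E162's data,
unitarity + the trace letters, `ρ_w` and the witnesses stay HYPOTHESES.  NOT summit progress (cell pub-balaban: NE9 NOT PRINTED ∕ NOT PROVED; «NE9 ⇐ the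
named binders»; row WALLED ON A MODEL (O-NE9-1; #5 UNRULED); spine PROVED 0∕9; rung (B)+1 finite T⁴ — NOT infinite volume, NOT mass gap, NOT BetaPertH,
NOT Clay).  HONEST DEPENDENCY (cell line): continuum YM on T⁴ ⇐ BetaPertH ∧ nine spine estimates (0/9 proved); BetaPertH ⇐ (D1) ∧ (D4) ∧ CAP+tail;
G-an2-4 gates asym, D1 and NE2/3/4.  NEW file; nothing modified.  Net new unproved facts: 0.
-/

noncomputable section

open scoped InnerProductSpace ComplexConjugate BigOperators

namespace Literature.MathematicalPhysics.QuantumFieldTheory.Balaban1983to89.B9Eq3126EnergyBallTowerCLM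

open B4Sect5Torus (TSite)
open B9SectCLatticeCarrier (Bond)
open B11Eq103H1Complex (SiteL2K BondL2K covDerivL2K covDivL2K laplaceALatticeK G1LatticeK H1LatticeK frakGLatticeK KinvLatticeK
  H1LatticeCLM frakGLatticeCLM)
open B11Eq115Space (NegSize Space115 levWeight)
open B11Eq111FrakG (nabla115)
open B11Eq117TransformationNorm (norm_H1CLM_le norm_frakG_fun_le norm_nabla115_le)
open B9Eq310HessianOperator (adTransportW hessOp)
open B9Eq310HessianHermitian (adTransportW_adjoint)
open B9Eq310DeltaPrime (plaqHolU)
open B9Eq315QTorus (perCfg cornerSite)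
open B9Eq315QTower (towerP UlevOf)
open B9Eq326OperatorTower (laplaceAk QkW RofUk laplaceAk_isSymmetric)
open B7Prop1Explicit (U1 Wcx boxVec)
open B9Eq3153FrakGkBoundDiagonal (exists_norm_frakGk_le_diagonal_closed)
open B9Eq3126H1BoundTowerVariational (exists_norm_KinvLatticeK_H1LatticeK_le_diagonal_closed)

variable {d : ℕ} (hd : 1 ≤ d) (L : ℕ) [NeZero L] (hL : 1 ≤ L)
  {𝔸 : Type*} [NormedRing 𝔸] [NormedAlgebra ℂ 𝔸] [CompleteSpace 𝔸] [NormOneClass 𝔸] [StarRing 𝔸] [NormedStarGroup 𝔸] [StarModule ℂ 𝔸]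
  [FiniteDimensional ℂ 𝔸]
  {W : Type*} [NormedAddCommGroup W] [InnerProductSpace ℂ W] [FiniteDimensional ℂ W] (φ : W ≃ₗ[ℂ] 𝔸)
  {Mφ Mφ' : ℝ} (hMφ : 0 ≤ Mφ) (hMφ' : 0 ≤ Mφ') (hφ : ∀ w, ‖φ w‖ ≤ Mφ * ‖w‖) (hφ' : ∀ X, ‖φ.symm X‖ ≤ Mφ' * ‖X‖)
  {a : ℝ} (ha : 0 < a) {r : ℝ} (hr0 : 0 ≤ r) (hr1 : r < 1)
  (τ : 𝔸 →ₗ[ℂ] ℂ) {Cτ : ℝ} (hτ : ∀ X, ‖τ X‖ ≤ Cτ * ‖X‖) (hCτ : 0 ≤ Cτ) {ρw : ℝ} (hρw : 0 ≤ ρw)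
  (hτ₁ : ∀ X : 𝔸, τ (star X) = conj (τ X)) (hτ₂ : ∀ X Y : 𝔸, τ (X * Y) = τ (Y * X))
  (hφτ : ∀ X Y : 𝔸, ⟪φ.symm X, φ.symm Y⟫_ℂ = τ (star X * Y))

include hd hMφ hMφ' hφ hφ' ha hr0 hr1 hτ hCτ hρw hτ₁ hτ₂ hφτ

/-- **THE (117)-ISOLATION FOR THE `k`-LEVEL CHART LETTERS ON THE DIAGONAL**: `∃ α₀ C > 0` (`C` closed in `(d, a, L, M_φ, M_φ′, r, C_τ, ρ_w)`) before every
lattice ∕ height ∕ weight ∕ volume ∕ level-map ∕ background binder; then for unitary `U` in the three windows and ANY witnesses `hposU hQU`: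
`‖H1LatticeCLM φ hposU hQU lev₁ (∇_U)‖ ≤ C·max(w̄₀, w̄₁·2|η|⁻¹)·(M_φ√(c₁#β_m)M_φ′∕√c₀)·w̲_B⁻¹` and
`‖frakGLatticeCLM φ hposU hQU lev₁ (∇_U)‖ ≤ C·max(w̄₀, w̄₁·2|η|⁻¹)·(M_φ√(c₀#β_k)M_φ′∕√c₀)·w̲₀⁻¹` — the `L²` letters level-free (NE9 leaf-02's `C_H`, this
lineage's `16∕γ(d,a)`), (117)'s finite-lattice factor DISPLAYED as the one remaining product.  NOT print's lattice-uniform `B₀` (Thm 3.13's decay).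
[cite: Balaban1985Variational, (103) p.293, (110)–(111) p.294, (115) p.294, (117) p.295; Balaban1985BackgroundPropagators, (3.126) p.420, (3.153) p.426, Thm 3.13 p.426] -/
theorem exists_energy_ball_CLM_diagonal_closed [Fact (0 < (L : ℝ))] :
    ∃ α₀ C : ℝ, 0 < α₀ ∧ 0 < C ∧ ∀ (n : ℕ) (η : ℝ) [Fact (0 < η)], η * (L : ℝ) ^ (n + 1) = 1 → 3 ≤ L ^ (n + 1) →
      ∀ (c₀ c₁ : ℝ) [Fact (0 < c₀)] [Fact (0 < c₁)], c₀ * ((L : ℝ) ^ (n + 1)) ^ d = c₁ → |η| ^ d / c₀ ≤ ρw →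
      ∀ (m : Fin d → ℕ) [∀ i, NeZero (m i)] (lev₀ : Bond d (towerP L m (n + 1)) → ℕ) (levB : Bond d m → ℕ)
        (lev₁ : Bond d (towerP L m (n + 1)) × Fin d → ℕ)
        (U : Bond d (towerP L m (n + 1)) → 𝔸ˣ) (αU : ℕ → ℝ) (hα1 : ∀ j, αU j ≤ 1 / 64)
        (hU1 : ∀ (j : ℕ) (x : B7Prop1Explicit.Site d) (κ : Fin d), perCfg (towerP L m (j + 1)) (UlevOf L m (n + 1) U j) x κ ∈ U1 𝔸)
        (hreg : ∀ (j : ℕ) (y : TSite d (towerP L m j)) (κ : Fin d) (r : Fin d → Fin L),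
          ‖((Wcx L (perCfg (towerP L m (j + 1)) (UlevOf L m (n + 1) U j)) (cornerSite L y) κ (boxVec L r) : 𝔸ˣ) : 𝔸) - 1‖ ≤ αU j)
        (εU : ℕ → ℝ), (∀ j, 0 ≤ εU j) → (∀ (j : ℕ) (b : Bond d (towerP L m (j + 1))), ‖(UlevOf L m (n + 1) U j b : 𝔸) - 1‖ ≤ εU j) →
      ∀ {α : ℝ}, 0 ≤ α → α ≤ α₀ →
        (∀ b, star (U b : 𝔸) = (((U b)⁻¹ : 𝔸ˣ) : 𝔸)) →
        (∀ b, U b ∈ U1 𝔸) → (∀ b, ‖(U b : 𝔸) - 1‖ ≤ α * η) →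
        (∀ p : B9SectCLatticeCarrier.Plaq d (towerP L m (n + 1)), ‖(plaqHolU U p : 𝔸) - 1‖ ≤ α * η ^ 2) →
        (∀ j < n + 1, εU j ≤ α * r ^ j) →
        ∀ (hposU : ∀ x : BondL2K ℂ d (towerP L m (n + 1)) c₀ W, x ≠ 0 →
            0 < RCLike.re ⟪x, laplaceAk L m n φ η U hL αU hα1 hU1 hreg τ (c₀ := c₀) (c₁ := c₁) a x⟫_ℂ)
          (hQU : Function.Surjective (QkW L m n φ U hL αU hα1 hU1 hreg (c₀ := c₀) (c₁ := c₁))),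
        ‖H1LatticeCLM (L := (L : ℝ)) (η := η) (lev₀ := lev₀) (levB := levB) φ hposU hQU lev₁ (nabla115 η U)‖ ≤
            C * (max (B11Eq115Space.NegSup.wSup (levWeight (L : ℝ) η lev₀ 1) : ℝ)
                (B11Eq115Space.NegSup.wSup (levWeight (L : ℝ) η lev₁ 2) * (2 * ‖((η : ℂ))⁻¹‖)) *
              (Mφ * Real.sqrt (c₁ * Fintype.card (Bond d m)) * Mφ' / Real.sqrt c₀) *
              B11Eq115Space.NegSup.wInvSup (levWeight (L : ℝ) η levB 0)) ∧
        ‖frakGLatticeCLM (L := (L : ℝ)) (η := η) (lev₀ := lev₀) φ hposU hQU lev₁ (nabla115 η U)‖ ≤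
            C * (max (B11Eq115Space.NegSup.wSup (levWeight (L : ℝ) η lev₀ 1) : ℝ)
                (B11Eq115Space.NegSup.wSup (levWeight (L : ℝ) η lev₁ 2) * (2 * ‖((η : ℂ))⁻¹‖)) *
              (Mφ * Real.sqrt (c₀ * Fintype.card (Bond d (towerP L m (n + 1)))) * Mφ' / Real.sqrt c₀) *
              B11Eq115Space.NegSup.wInvSup (levWeight (L : ℝ) η lev₀ 3)) := by
  -- the two level-free `L²` letters
  obtain ⟨αK, CKU, CH, hαK, hCKU, hCH, HK⟩ :=
    exists_norm_KinvLatticeK_H1LatticeK_le_diagonal_closed hd L hL φ hMφ hMφ' hφ hφ' ha hr0 hr1 τ hτ hCτ hρw hτ₁ hτ₂ hφτ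
  obtain ⟨αF, CF, hαF, hCF, HF⟩ := exists_norm_frakGk_le_diagonal_closed (d := d) L hL φ hMφ hMφ' hφ hφ' ha hr0 hr1 τ hτ hCτ hρw
  refine ⟨min αK αF, CH + CF, lt_min hαK hαF, add_pos hCH hCF, ?_⟩
  intro n η _ hηL hL3 c₀ c₁ _ _ hw hρ m _ lev₀ levB lev₁ U αU hα1 hU1 hreg εU hεU hUε α hα0 hαle hUst hUb hUη hpl hεg hposU hQU
  have hαK' : α ≤ αK := hαle.trans (min_le_left _ _)
  have hαF' : α ≤ αF := hαle.trans (min_le_right _ _)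
  -- `hRS` and the symmetry of `Δ_a(U)` from unitarity + the trace letters
  have hRS : ∀ (b : Bond d (towerP L m (n + 1))) (v u : W), ⟪adTransportW φ U b v, u⟫_ℂ = ⟪v, adTransportW φ (fun b => (U b)⁻¹) b u⟫_ℂ :=
    adTransportW_adjoint φ τ hτ₂ hUst hφτ
  have hsymm := laplaceAk_isSymmetric L m n φ η U hL αU hα1 hU1 hreg τ (c₀ := c₀) (c₁ := c₁) hUst hτ₁ hτ₂ hφτ a
  -- the `L²` letters at this background, weakened to the common constant `C_H + C_F`
  have hH : ∀ b : BondL2K ℂ d m c₁ W, ‖H1LatticeK hposU hQU b‖ ≤ (CH + CF) * ‖b‖ := fun b =>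
    ((HK n η hηL hL3 c₀ c₁ hw hρ m U αU hα1 hU1 hreg εU hεU hUε hα0 hαK' hUst hUb hUη hpl hεg hposU hQU).2 b).trans
      (mul_le_mul_of_nonneg_right (le_add_of_nonneg_right hCF.le) (norm_nonneg _))
  have hG : ∀ x : BondL2K ℂ d (towerP L m (n + 1)) c₀ W,
      ‖B11Eq111FrakG.frakGLin (G1LatticeK hposU) (QkW L m n φ U hL αU hα1 hU1 hreg (c₀ := c₀) (c₁ := c₁))
        (LinearMap.adjoint (QkW L m n φ U hL αU hα1 hU1 hreg (c₀ := c₀) (c₁ := c₁))) (KinvLatticeK hposU hQU)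
        (covDerivL2K ℂ c₀ ((η : ℂ))⁻¹ (adTransportW φ U)) (RofUk L m n φ η U)
        (covDivL2K ℂ c₀ ((η : ℂ))⁻¹ (adTransportW φ fun b => (U b)⁻¹)) x‖ ≤ (CH + CF) * ‖x‖ := fun x =>
    ((HF n η hηL c₀ c₁ hw hρ m U αU hα1 hU1 hreg εU hεU hUε hα0 hαF' hRS hUb hUη hpl hεg hsymm hposU hQU x).1).trans
      (mul_le_mul_of_nonneg_right (le_add_of_nonneg_left hCH.le) (norm_nonneg _))
  -- `‖∇_U‖ ≤ 2|η|⁻¹` from the unit-boundedness of the bond variables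
  have hUb' : ∀ b : Bond d (towerP L m (n + 1)), ‖(U b : 𝔸)‖ ≤ 1 ∧ ‖(((U b)⁻¹ : 𝔸ˣ) : 𝔸)‖ ≤ 1 := fun b =>
    B7Prop1Explicit.mem_U1.1 (hUb b)
  have hD : ∀ g : Bond d (towerP L m (n + 1)) → 𝔸, ‖nabla115 η U g‖ ≤ (2 * ‖((η : ℂ))⁻¹‖) * ‖g‖ := fun g =>
    norm_nabla115_le η U hUb' g
  have hC0 : 0 ≤ CH + CF := (add_pos hCH hCF).le
  refine ⟨?_, ?_⟩
  · have h := norm_H1CLM_le (L := (L : ℝ)) (η := η) (lev₀ := lev₀) (levB := levB) φ hMφ hφ hMφ' hφ' lev₁ (nabla115 η U)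
      (H1LatticeK hposU hQU) hC0 hH hD
    exact le_of_le_of_eq h (by ring)
  · have h := norm_frakG_fun_le (L := (L : ℝ)) (η := η) (lev₀ := lev₀) φ hMφ hφ hMφ' hφ' lev₁ (nabla115 η U) (G1LatticeK hposU)
      (QkW L m n φ U hL αU hα1 hU1 hreg (c₀ := c₀) (c₁ := c₁)) (KinvLatticeK hposU hQU) (covDerivL2K ℂ c₀ ((η : ℂ))⁻¹ (adTransportW φ U))
      (RofUk L m n φ η U) (covDivL2K ℂ c₀ ((η : ℂ))⁻¹ (adTransportW φ fun b => (U b)⁻¹)) hC0 hG hD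
    exact le_of_le_of_eq h (by ring)

end Literature.MathematicalPhysics.QuantumFieldTheory.Balaban1983to89.B9Eq3126EnergyBallTowerCLM

end
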